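import Mathlib
import HarnessLib
import Literature.Analysis.FluidPDE.SelfSimilar
import Literature.Analysis.FluidPDE.VectorCalculus
import Literature.Analysis.FluidPDE.VorticityCalculus
import Literature.Analysis.FluidPDE.TaoLocalVelocityGradient
import Summits.NavierStokesRegularity.NavierStokesRegularity.Theorems.UnthreadedDoorConstantOfIrrotational

/-!
# Route `UnthreadedDoor` / `ThreadingFlux`, crux `PoloidalLiouville` (stmt-NavierStokesRegularity-1222), antidynamo v2 skeleton
# (sha16 `4ebf5683127b`), plan-only rung `stub_singleDegreeRung` (BC5): the GRADIENT BRANCH, with the junk `gradient` handled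

Support file (seat leafhand-ns-unthreadeddoor-1 g0, cell decomp-ns), `--supports stmt-NavierStokesRegularity-1222 --as helper`.

The registered rung `StubSingleDegreeRung` quantifies, at every `t < 0`, over ARBITRARY functions `g : ℝ → ℝ` and `φ : ℝ³ → ℝ` with
`v t x = gradient φ x + (g ‖x − x₀‖ · P(x − x₀)) • (x − x₀)`; no regularity of `g`, `φ` is assumed, and Mathlib's `gradient φ x` is the
junk value `0` wherever `φ` is not differentiable.  Any proof of the rung therefore has to extract the regularity it needs from the
smoothness of `v` alone.  This file does that for the gradient part and settles the branch of the rung in which the toroidal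
coefficient vanishes identically (`g ‖x − x₀‖ · P(x − x₀) ≡ 0`, in particular `P = 0` or `g ≡ 0`):

* `curl_gradient_eq_zero_of_contDiffOn` — LOCAL form of the tree's `curl_gradient_eq_zero_holds`: `curl (∇θ) y = 0` for `θ` of class
  `C²` on an open set `U ∋ y` (bump-function localisation).
* ★ `curl_eq_zero_of_forall_gradient_eq` — JUNK-AWARE curl-freeness: if a `C¹` field `F` coincides EVERYWHERE with Mathlib's
  `gradient φ` of an ARBITRARY `φ`, then `curl F ≡ 0`.  Proof: let `D` be the differentiability set of `φ` and `U = interior D`.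
  On `U`, `Dφ = ⟪F, ·⟫` is `C¹`, so `φ ∈ C²(U)` and `curl F = curl ∇φ = 0` there, hence on `closure U` by continuity of `curl F`;
  off `closure U` we are in the open set `interior (closure Dᶜ)`, and `F = ∇φ = 0` on `Dᶜ`, hence on its closure, so `F ≡ 0`
  near the point and `curl F = 0`.
* ★ `constant_of_forall_gradient_slices` — a bounded ancient mild solution (duality class, `ν = 1`), jointly smooth on
  `(−∞,0) × ℝ³`, all of whose slices are (junk-)gradients, has constant slices (`curl ≡ 0` by the previous lemma, then the tree's
  `PoloidalLiouville.constantOfIrrotational`).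
* ★ `singleDegreeRung_of_toroidalCoeff_eq_zero` — the rung's conclusion under the rung's hypotheses PLUS the branch condition
  `∀ x, g ‖x − x₀‖ * P(x − x₀) = 0` at each time (covers `P = 0` and `g ≡ 0`).

WHAT REMAINS OF THE RUNG (census, not claimed): the branch `g · P ≢ 0` — there `curl v(t) = g(‖y‖) (∇P(y) × y)` (`y = x − x₀`) once
`g` is shown smooth on the radii where it is visible, and the Navier–Stokes dynamics must force `g ≡ 0` (non-zonal `P`) or reduce to
KNSS Thm 5.2 up to a Galilean drift (zonal `P`); both are open pieces of the line, sized L.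

HONEST LABEL: a sub-case of a PLAN-ONLY stub not used by the composition `PoloidalLiouville_of`; nothing here proves the rung, the wall
`stub_scalarLiouville`, `PoloidalLiouville` (1222) or bears on NS regularity.  [folklore]
-/

noncomputable section

-- the summit and its single sub-problem share the name (CONVENTIONS §1)
set_option linter.dupNamespace false

open scoped Topology InnerProductSpace RealInnerProductSpace ContDiff
open Filter Set Function MeasureTheory Metric
open Literature.Analysis.FluidPDE

namespace Summit.NavierStokesRegularity.NavierStokesRegularity.Theorems.PoloidalLiouville.Antidynamo

/-- LOCAL curl-of-gradient: if `θ : ℝ³ → ℝ` is `C²` on an open set `U` and `y ∈ U`, then `curl (∇θ) y = 0`.  Localisation of the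
tree's global `curl_gradient_eq_zero_holds` with a smooth bump `≡ 1` near `y` supported in `U`. [folklore] -/
theorem curl_gradient_eq_zero_of_contDiffOn {θ : EuclideanSpace ℝ (Fin 3) → ℝ} {U : Set (EuclideanSpace ℝ (Fin 3))}
    (hU : IsOpen U) (hθ : ContDiffOn ℝ 2 θ U) {y : EuclideanSpace ℝ (Fin 3)} (hy : y ∈ U) :
    curl (gradient θ) y = 0 := by
  obtain ⟨r, hr, hball⟩ := Metric.isOpen_iff.1 hU y hy
  let b : ContDiffBump y := ⟨r / 4, r / 2, by positivity, by linarith⟩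
  set θ' : EuclideanSpace ℝ (Fin 3) → ℝ := fun z => b z * θ z with hθ'
  have hsupp : tsupport (b : EuclideanSpace ℝ (Fin 3) → ℝ) ⊆ U := by
    rw [b.tsupport_eq]
    exact (closedBall_subset_ball (by show r / 2 < r; linarith)).trans hball
  have hθ'2 : ContDiff ℝ 2 θ' := by
    rw [contDiff_iff_contDiffAt]
    intro z
    by_cases hz : z ∈ U
    · exact (b.contDiff (n := 2)).contDiffAt.mul (hθ.contDiffAt (hU.mem_nhds hz))
    · have hb0 : (b : EuclideanSpace ℝ (Fin 3) → ℝ) =ᶠ[𝓝 z] 0 :=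
        notMem_tsupport_iff_eventuallyEq.1 fun h => hz (hsupp h)
      have h0 : θ' =ᶠ[𝓝 z] fun _ => 0 := hb0.mono fun w hw => by
        simp only [hθ', hw, Pi.zero_apply, zero_mul]
      exact contDiffAt_const.congr_of_eventuallyEq h0
  have heq : θ' =ᶠ[𝓝 y] θ := (b.eventuallyEq_one).mono fun w hw => by
    simp only [hθ', hw, Pi.one_apply, one_mul]
  have hgrad : gradient θ' =ᶠ[𝓝 y] gradient θ := heq.gradient
  rw [← curl_congr_of_eventuallyEq hgrad]
  exact curl_gradient_eq_zero_holds θ' hθ'2 y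

/-- ★ JUNK-AWARE CURL-FREENESS.  If a `C¹` vector field `F : ℝ³ → ℝ³` coincides at EVERY point with Mathlib's `gradient φ` of an
arbitrary function `φ : ℝ³ → ℝ` (no regularity assumed; `gradient φ x = 0` where `φ` is not differentiable), then `curl F ≡ 0`.
Topology of the differentiability set `D` of `φ`: `curl F = 0` on `interior D` (there `φ ∈ C²`), hence on its closure; the complement
of that closure is the open set `interior (closure Dᶜ)`, on which `F` vanishes identically (it vanishes on `Dᶜ` and is continuous).
[folklore] -/
theorem curl_eq_zero_of_forall_gradient_eq {φ : EuclideanSpace ℝ (Fin 3) → ℝ}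
    {F : EuclideanSpace ℝ (Fin 3) → EuclideanSpace ℝ (Fin 3)} (hF : ContDiff ℝ 1 F)
    (h : ∀ x, gradient φ x = F x) (x : EuclideanSpace ℝ (Fin 3)) : curl F x = 0 := by
  set D : Set (EuclideanSpace ℝ (Fin 3)) := {z | DifferentiableAt ℝ φ z} with hD
  set U : Set (EuclideanSpace ℝ (Fin 3)) := interior D with hUdef
  have hUo : IsOpen U := isOpen_interior
  -- `F` vanishes off `D`, hence on `closure Dᶜ`
  have hF0 : ∀ z, z ∉ D → F z = 0 := fun z hz => by
    rw [← h z]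
    exact gradient_eq_zero_of_not_differentiableAt hz
  have hFcl : closure Dᶜ ⊆ {z | F z = 0} :=
    closure_minimal (fun z hz => hF0 z hz) (isClosed_eq hF.continuous continuous_const)
  -- `φ` is `C²` on `U`
  have hφU : ContDiffOn ℝ 2 φ U := by
    have hdiff : DifferentiableOn ℝ φ U := fun z hz =>
      (interior_subset (s := D) hz : DifferentiableAt ℝ φ z).differentiableWithinAt
    have hfd : ∀ z ∈ U, fderiv ℝ φ z = (InnerProductSpace.toDual ℝ (EuclideanSpace ℝ (Fin 3))) (F z) := by
      intro z _
      rw [← h z, gradient, LinearIsometryEquiv.apply_symm_apply]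
    have h1 : ContDiffOn ℝ 1 (fderiv ℝ φ) U :=
      (((InnerProductSpace.toDual ℝ (EuclideanSpace ℝ (Fin 3))).contDiff.comp hF).contDiffOn).congr hfd
    rw [show (2 : WithTop ℕ∞) = 1 + 1 by norm_num, contDiffOn_succ_iff_fderiv_of_isOpen hUo]
    exact ⟨hdiff, fun h1ω => absurd h1ω (by simp), h1⟩
  -- `curl F = 0` on `U`
  have hcurlU : ∀ z ∈ U, curl F z = 0 := by
    intro z hz
    have hg : gradient φ = F := funext h
    rw [← hg]
    exact curl_gradient_eq_zero_of_contDiffOn hUo hφU hz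
  by_cases hx : x ∈ closure U
  · -- by continuity of `curl F`
    have hcl : closure U ⊆ {z | curl F z = 0} :=
      closure_minimal hcurlU (isClosed_eq (continuous_curl hF) continuous_const)
    exact hcl hx
  · -- `x` lies in the open set `(closure U)ᶜ = interior (closure Dᶜ)`, where `F ≡ 0`
    have hW : (closure U)ᶜ ⊆ closure Dᶜ := by
      rw [← interior_compl, hUdef, ← closure_compl]
      exact interior_subset
    have hFx : F =ᶠ[𝓝 x] fun _ => 0 := by
      filter_upwards [isClosed_closure.isOpen_compl.mem_nhds hx] with z hz
      exact hFcl (hW hz)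
    rw [curl_congr_of_eventuallyEq hFx]
    exact curl_fun_zero x

/-- ★ GRADIENT SLICES ARE CONSTANT (duality class).  A bounded ancient mild solution of Navier–Stokes (`ν = 1`, the tree's duality
class) whose velocity is jointly `C^∞` on `(−∞,0) × ℝ³` and each of whose slices coincides pointwise with Mathlib's `gradient` of SOME
function (no regularity assumed) has spatially constant slices: `curl v(t) ≡ 0` by `curl_eq_zero_of_forall_gradient_eq`, then the
tree's curl-free Liouville step `PoloidalLiouville.constantOfIrrotational`. [folklore] -/
theorem constant_of_forall_gradient_slices
    (v : ℝ → EuclideanSpace ℝ (Fin 3) → EuclideanSpace ℝ (Fin 3))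
    (hB : Literature.Analysis.FluidPDE.IsBoundedAncientMildSolution 1 v)
    (hsm : ContDiffOn ℝ (⊤ : ℕ∞) (Function.uncurry v) (Set.Iio 0 ×ˢ Set.univ))
    (hgrad : ∀ t < 0, ∃ φ : EuclideanSpace ℝ (Fin 3) → ℝ, ∀ x, v t x = gradient φ x) :
    ∀ t < 0, ∃ b : EuclideanSpace ℝ (Fin 3), ∀ x, v t x = b := by
  have hsm' : IsSmoothSpaceTimeOn (Iio 0) v := hsm
  have hcurl : ∀ s < 0, ∀ x, curl (v s) x = 0 := by
    intro s hs x
    obtain ⟨φ, hφ⟩ := hgrad s hs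
    have h1 : ContDiff ℝ 1 (v s) := (hsm'.contDiff_slice hs).of_le (by norm_cast)
    exact curl_eq_zero_of_forall_gradient_eq h1 (fun z => (hφ z).symm) x
  exact PoloidalLiouville.constantOfIrrotational v hB hsm hcurl

/-- ★ THE GRADIENT BRANCH OF THE RUNG `stub_singleDegreeRung` (antidynamo v2, BC5).  Under the rung's hypotheses — a bounded ancient
mild solution with measurable slices, jointly smooth on `(−∞,0) × ℝ³`, of the single-degree form
`v t x = gradient φ x + (g ‖x − x₀‖ · P(x − x₀)) • (x − x₀)` at every `t < 0` for a solid harmonic `P` of degree `l ≥ 2` — and the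
BRANCH CONDITION that the toroidal coefficient vanishes identically at each time (`g ‖x − x₀‖ · P(x − x₀) = 0` for all `x`; e.g.
`P = 0` or `g ≡ 0`), every slice is spatially constant.  The complementary branch (`g · P ≢ 0`) is the open content of the rung.
[folklore] -/
theorem singleDegreeRung_of_toroidalCoeff_eq_zero
    (v : ℝ → EuclideanSpace ℝ (Fin 3) → EuclideanSpace ℝ (Fin 3)) (x₀ : EuclideanSpace ℝ (Fin 3))
    (hB : Literature.Analysis.FluidPDE.IsBoundedAncientMildSolution 1 v)
    (_hm : ∀ t < 0, AEStronglyMeasurable (v t) volume)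
    (hsm : ContDiffOn ℝ (⊤ : ℕ∞) (Function.uncurry v) (Set.Iio 0 ×ˢ Set.univ))
    (hform : ∃ (l : ℕ) (P : MvPolynomial (Fin 3) ℝ), 2 ≤ l ∧ P.IsHomogeneous l ∧
      (∀ y : EuclideanSpace ℝ (Fin 3),
        Laplacian.laplacian (fun z : EuclideanSpace ℝ (Fin 3) => MvPolynomial.eval (fun i => z i) P) y = 0) ∧
      ∀ t < 0, ∃ (g : ℝ → ℝ) (φ : EuclideanSpace ℝ (Fin 3) → ℝ),
        (∀ x, g ‖x - x₀‖ * MvPolynomial.eval (fun i => (x - x₀) i) P = 0) ∧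
        ∀ x, v t x = gradient φ x + (g ‖x - x₀‖ * MvPolynomial.eval (fun i => (x - x₀) i) P) • (x - x₀)) :
    ∀ t < 0, ∃ b : EuclideanSpace ℝ (Fin 3), ∀ x, v t x = b := by
  obtain ⟨_, P, -, -, -, hrep⟩ := hform
  refine constant_of_forall_gradient_slices v hB hsm fun t ht => ?_
  obtain ⟨g, φ, hzero, hv⟩ := hrep t ht
  exact ⟨φ, fun x => by rw [hv x, hzero x, zero_smul, add_zero]⟩

end Summit.NavierStokesRegularity.NavierStokesRegularity.Theorems.PoloidalLiouville.Antidynamo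

end
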